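import Summits.AtomisticToContinuum.BoseEinsteinCondensation.Theorems.BECInsertionCorrectorCorrectorClosureConcentrationOfMomentsPhase
import Summits.AtomisticToContinuum.BoseEinsteinCondensation.Theorems.BECInsertionCorrectorCorrectorClosureConcentrationOfMomentsDictionary
import HarnessLib

/-!
# Crux `CorrectorClosure` (stmt-AtomisticToContinuum-12058), line `volume-homotopy-sum-rule-domination` —
# registered stub S3g `stub_concentrationOfMoments`: 12616′ from the two zero-mode moments

Supports (does not close) stmt-AtomisticToContinuum-12058, route `BECInsertionCorrector`.

Skeleton v3 of the line (`Cruxes/CorrectorClosure/Lines/volume_homotopy_sum_rule_domination.lean`)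
reshapes the density-uniform condensate-number concentration S3 = 12616′
(`E[N̂₀²] ≤ n₀² + ζN²` for every torus minimiser at every `L ≥ sideLength ρ₀ N`, PQSR item 12616 at
coupling `t = 1`) into the zero-mode moment module: the f-sum bound S3a (`𝓔_{|Φ|}(g_Φ,g_Φ) ≤ AρN` for the
zero-mode counting ratio `g_Φ = N̂₀Φ/Φ` of the positive minimiser `Φ`), the susceptibility S3b
(`‖g_Φ − ⟨g_Φ⟩‖²₋₁ ≤ B`, `AρN·B ≤ (ζN²)²`) and THIS glue `stub_concentrationOfMoments` (S3a-body ∧ S3b-body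
⊢ 12616′), proved here with the registered signature verbatim:

1. thresholds: given `ζ > 0` take `A, ρ_F` from the f-sum body and `ρ_S` from the susceptibility body at
   `(ζ, A)`; `ρ₀ := min ρ_F ρ_S`, so that `L ≥ sideLength ρ₀ N` implies both `L ≥ sideLength ρ_F N` and
   `L ≥ sideLength ρ_S N` (`sideLength_le_sideLength`), and the two `N`-thresholds are joined;
2. at such `(N, L)` the positive `C³` minimiser `Φ` exists (`PositiveMinimiser_proof`, item 11787) and the
   two bodies hold at `Φ`; the zero-mode dictionary and Kipnis–Varadhan's sandwich give 12616′ AT `Φ`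
   (`cm_concentration_at`, auxiliary file `…ConcentrationOfMomentsDictionary`);
3. every minimiser `Ψ` at `(N, L)` is `cΦ` with `|c| = 1` (`cm_exists_phase_eq_of_minimisers`, auxiliary
   file `…ConcentrationOfMomentsPhase`), and both sides of 12616′ are invariant under a global phase
   (`cm_pairTerm_const_mul`, `condensateOccupation_const_mul_of_norm_eq_one`).

## References

* [PitaevskiiStringari1991] L. Pitaevskii, S. Stringari, *Uncertainty principle, quantum fluctuations,
  and broken symmetries*, J. Low Temp. Phys. 85 (1991), (9) (the moment sandwich `Var² ≤ m₋₁ m₁`).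
* [KipnisLandim1999] C. Kipnis, C. Landim, *Scaling Limits of Interacting Particle Systems*, App. 1 §6
  (6.1) (the `H₋₁` variational formula).
* [ReedSimonIV1978] M. Reed, B. Simon, *Methods of Modern Mathematical Physics IV*, §XIII.12 (nondegenerate
  positive ground state of the torus Bose gas).
-/

noncomputable section

open MeasureTheory Filter Matrix
open scoped ENNReal NNReal BigOperators ComplexConjugate

namespace Summit.AtomisticToContinuum.BoseEinsteinCondensation.Theorems.CorrectorClosure.VolumeHomotopySumRuleDomination

open Literature.MathematicalPhysics.QuantumManyBody.BoseGas
open Summit.AtomisticToContinuum.BoseEinsteinCondensation.Theses.BECInsertionCorrector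
open Summit.AtomisticToContinuum.BoseEinsteinCondensation.Theorems.StaticResponseBound.Negative
  (sideLength_pos)

/-- **The concentration inequality 12616′ transfers along a global phase.** If `Ψ = cΦ` pointwise with
`|c| = 1`, both the pair integral and the condensate occupation of `Ψ` are those of `Φ`, so 12616′ at `Φ`
is 12616′ at `Ψ`. [folklore] -/
theorem cm_concentration_of_phase_eq {n : ℕ} {L : ℝ} {Ψ Φ : Config (n + 2) → ℂ} {c : ℂ} (hc : ‖c‖ = 1)
    (hΨ : ∀ X, Ψ X = c * Φ X) {ζ : ℝ}
    (h : ((n + 2 : ℕ) : ℝ≥0∞) * ((n + 1 : ℕ) : ℝ≥0∞) *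
      (∫⁻ Y in cellN n L,
      (‖∫ x in cell L, ∫ y in cell L, Φ (vecCons x (vecCons y Y))‖₊ : ℝ≥0∞) ^ 2) /
      ENNReal.ofReal (L ^ 6) +
      condensateOccupation (n + 2) L Φ ≤
      condensateOccupation (n + 2) L Φ ^ 2 + ENNReal.ofReal (ζ * ((n : ℝ) + 2) ^ 2)) :
    ((n + 2 : ℕ) : ℝ≥0∞) * ((n + 1 : ℕ) : ℝ≥0∞) *
      (∫⁻ Y in cellN n L,
      (‖∫ x in cell L, ∫ y in cell L, Ψ (vecCons x (vecCons y Y))‖₊ : ℝ≥0∞) ^ 2) /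
      ENNReal.ofReal (L ^ 6) +
      condensateOccupation (n + 2) L Ψ ≤
      condensateOccupation (n + 2) L Ψ ^ 2 + ENNReal.ofReal (ζ * ((n : ℝ) + 2) ^ 2) := by
  have hΨeq : Ψ = fun X => c * Φ X := funext hΨ
  rw [hΨeq, condensateOccupation_const_mul_of_norm_eq_one _ _ hc]
  simp only [cm_pairTerm_const_mul L hc Φ]
  exact h

/-- **S3g — CONCENTRATION FROM THE TWO MOMENTS: S3a-body ∧ S3b-body ⊢ S3 (12616′) at `v`** (registered
stub `stub_concentrationOfMoments` of line `volume-homotopy-sum-rule-domination`, signature verbatim).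
Given the zero-mode f-sum body `hF` (`𝓔_{|Φ|}(g_Φ, g_Φ) ≤ AρN` for the zero-mode counting ratio
`g_Φ = N̂₀Φ/Φ` of every real positive `C³` minimiser `Φ`, density-uniformly) and the zero-mode
susceptibility body `hS` (`‖g_Φ − ⟨g_Φ⟩‖²₋₁ ≤ B`, `AρN·B ≤ (ζN²)²`), every minimiser `Ψ` of `n + 2` bosons
at every `L ≥ sideLength ρ₀ (n+2)`, `n` large, satisfies
`N(N−1)L⁻⁶∫|∫∫Ψ|² + n₀(Ψ) ≤ n₀(Ψ)² + ζN²`, i.e. `E[N̂₀²] ≤ n₀² + ζN²`. Proof: thresholds `ρ₀ = min ρ_F ρ_S`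
and joined `n`-thresholds; the positive minimiser `Φ` (`PositiveMinimiser_proof`); 12616′ at `Φ` by the
zero-mode dictionary and Kipnis–Varadhan's sandwich (`cm_concentration_at`); phase rigidity `Ψ = cΦ`
(`cm_exists_phase_eq_of_minimisers`) and phase invariance of both sides. [folklore] -/
theorem stub_concentrationOfMoments (v : ℝ → ℝ≥0∞) (hv : IsRepulsiveFiniteRange v)
    (hfin : ∀ r, v r ≠ ⊤) (hC2 : ContDiff ℝ 2 (fun x : Space => (v ‖x‖).toReal))
    (hedge : ∃ Cₑ : ℝ, ∀ x : Space,
      ‖iteratedFDeriv ℝ 2 (fun x : Space => (v ‖x‖).toReal) x‖ ≤ Cₑ * Real.sqrt ((v ‖x‖).toReal))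
    (hF : ∃ A : ℝ, 0 ≤ A ∧ ∃ ρ₀ : ℝ, 0 < ρ₀ ∧ ∀ᶠ n : ℕ in atTop, ∀ L : ℝ, sideLength ρ₀ (n + 2) ≤ L →
      ∀ Φ : PeriodicTrialState (n + 2) L,
        periodicEnergy v Φ = periodicGroundStateEnergy v (n + 2) L → periodicEnergy v Φ ≠ ⊤ →
        ContDiff ℝ 3 Φ.ψ → (∀ X, Φ.ψ X = (‖Φ.ψ X‖ : ℂ)) → (∀ X, Φ.ψ X ≠ 0) →
        IsPeriodicTest L (fun X =>
            (∑ j, (L ^ 3)⁻¹ * ∫ y in cell L, ‖Φ.ψ (Function.update X j y)‖) / ‖Φ.ψ X‖) ∧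
          dirichletFormW L (fun X => ‖Φ.ψ X‖)
              (fun X => (∑ j, (L ^ 3)⁻¹ * ∫ y in cell L, ‖Φ.ψ (Function.update X j y)‖) / ‖Φ.ψ X‖)
              (fun X => (∑ j, (L ^ 3)⁻¹ * ∫ y in cell L, ‖Φ.ψ (Function.update X j y)‖) / ‖Φ.ψ X‖) ≤
            A * (((n : ℝ) + 2) / L ^ 3) * ((n : ℝ) + 2))
    (hS : ∀ ζ : ℝ, 0 < ζ → ∀ A : ℝ, 0 ≤ A → ∃ ρ₀ : ℝ, 0 < ρ₀ ∧ ∀ᶠ n : ℕ in atTop, ∀ L : ℝ,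
      sideLength ρ₀ (n + 2) ≤ L → ∀ Φ : PeriodicTrialState (n + 2) L,
        periodicEnergy v Φ = periodicGroundStateEnergy v (n + 2) L → periodicEnergy v Φ ≠ ⊤ →
        ContDiff ℝ 3 Φ.ψ → (∀ X, Φ.ψ X = (‖Φ.ψ X‖ : ℂ)) → (∀ X, Φ.ψ X ≠ 0) →
        ∃ B : ℝ, 0 ≤ B ∧
          hMinusOneSqW L (fun X => ‖Φ.ψ X‖)
              (fun X => (∑ j, (L ^ 3)⁻¹ * ∫ y in cell L, ‖Φ.ψ (Function.update X j y)‖) / ‖Φ.ψ X‖ -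
                ∫ Y in cellN (n + 2) L,
                  (∑ j, (L ^ 3)⁻¹ * ∫ y in cell L, ‖Φ.ψ (Function.update Y j y)‖) / ‖Φ.ψ Y‖ *
                    ‖Φ.ψ Y‖ ^ 2) ≤ ENNReal.ofReal B ∧
          A * (((n : ℝ) + 2) / L ^ 3) * ((n : ℝ) + 2) * B ≤ (ζ * ((n : ℝ) + 2) ^ 2) ^ 2) :
    ∀ ζ : ℝ, 0 < ζ → ∃ ρ₀ : ℝ, 0 < ρ₀ ∧ ∀ᶠ n : ℕ in atTop, ∀ L : ℝ, sideLength ρ₀ (n + 2) ≤ L →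
      ∀ Ψ : PeriodicTrialState (n + 2) L,
      periodicEnergy v Ψ = periodicGroundStateEnergy v (n + 2) L → periodicEnergy v Ψ ≠ ⊤ →
      ((n + 2 : ℕ) : ℝ≥0∞) * ((n + 1 : ℕ) : ℝ≥0∞) *
      (∫⁻ Y in cellN n L,
      (‖∫ x in cell L, ∫ y in cell L, Ψ.ψ (vecCons x (vecCons y Y))‖₊ : ℝ≥0∞) ^ 2) /
      ENNReal.ofReal (L ^ 6) +
      condensateOccupation (n + 2) L Ψ.ψ ≤
      condensateOccupation (n + 2) L Ψ.ψ ^ 2 + ENNReal.ofReal (ζ * ((n : ℝ) + 2) ^ 2) := by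
  intro ζ hζ
  obtain ⟨A, hA, ρF, hρF, hevF⟩ := hF
  obtain ⟨ρS, hρS, hevS⟩ := hS ζ hζ A hA
  have hρ₀ : 0 < min ρF ρS := lt_min hρF hρS
  refine ⟨min ρF ρS, hρ₀, ?_⟩
  filter_upwards [hevF, hevS] with n hFn hSn L hL₀ Ψ hΨE hΨfin
  -- the box is large enough for both bodies, and non-degenerate
  have hL : 0 < L := (sideLength_pos hρ₀ (Nat.succ_pos (n + 1))).trans_le hL₀
  have hLF : sideLength ρF (n + 2) ≤ L := (sideLength_le_sideLength hρ₀ (min_le_left _ _) _).trans hL₀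
  have hLS : sideLength ρS (n + 2) ≤ L := (sideLength_le_sideLength hρ₀ (min_le_right _ _) _).trans hL₀
  -- the positive minimiser `Φ` and the phase `Ψ = cΦ`
  obtain ⟨Φ, hΦE, hΦfin, hΦ3, hΦreal, hΦne, c, hc, hΨc⟩ := cm_exists_positive_phase hv hfin hC2 hedge hL Ψ hΨE
  -- the two bodies at `Φ`
  obtain ⟨hPT, hDir⟩ := hFn L hLF Φ hΦE hΦfin hΦ3 hΦreal hΦne
  obtain ⟨B, hB0, hH, hAB⟩ := hSn L hLS Φ hΦE hΦfin hΦ3 hΦreal hΦne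
  -- 12616′ at `Φ`, then at `Ψ`
  refine cm_concentration_of_phase_eq hc hΨc ?_
  exact cm_concentration_at hL Φ (F := fun X => ‖Φ.ψ X‖)
    (G := fun X => ∑ j, (L ^ 3)⁻¹ * ∫ y in cell L, ‖Φ.ψ (Function.update X j y)‖) hΦreal
    (fun X => norm_pos_iff.2 (hΦne X)) (fun X => rfl) hB0 hζ.le hPT hDir hH hAB

end Summit.AtomisticToContinuum.BoseEinsteinCondensation.Theorems.CorrectorClosure.VolumeHomotopySumRuleDomination

end
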